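import Summits.BirchSwinnertonDyer.BirchSwinnertonDyer.Theorems.Rank2Observatory2DescKillSig8
import Summits.BirchSwinnertonDyer.BirchSwinnertonDyer.Theorems.ShaPrimaryTransferFiniteShaComponentTransferSelmerCubicKillCertMod
import HarnessLib

/-!
# BirchSwinnertonDyer — SEL2CUBIC kill layer: the certificate `sig8Check` in RESIDUE form

HONEST FRAMING: route `ShaPrimaryTransfer`, seat `bsd-line-spt-p1` (g30), `--supports` item T =
`FiniteShaComponentTransfer` (stmt-22356), UNCHANGED (conjecture-grade at corank ≥ 2). BSD in rank ≥ 2 is NOT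
proved by any of this. THEOREMS ONLY.

As `…SelmerCubicKillCertMod`, for the `2`-adic signature certificate with three `ℤ₂`-roots
(`Rank2Observatory2DescKillSig8`): `sig8Check_sound_mod` — the tree's `sig8Check_sound` verbatim with
`root_rel_mod` under the hypothesis `2^N ∣ Q₁(v), Q₂(v)`, the statement a `2`-Selmer class contradicts.
[cite: Cassels1991LecturesEllipticCurves, §15] [cite: CremonaAlgorithms1997, §3.6]
-/

-- single-conjunct summit: `Summit.BirchSwinnertonDyer.BirchSwinnertonDyer.…` repeats the name by design
set_option linter.dupNamespace false

namespace Summit.BirchSwinnertonDyer.BirchSwinnertonDyer.Theorems.ShaPrimaryTransferSelmerCubicKill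

open Summit.BirchSwinnertonDyer.BirchSwinnertonDyer.Rank2Observatory
open Summit.BirchSwinnertonDyer.BirchSwinnertonDyer.Rank2Observatory.TwoDescKill

/-- **Soundness of `sig8Check`, residue form**: if `sig8Check … N ε₁ ε₂ ε₃ = true` then no integer vector
primitive at `2` has `2^N ∣ Q₁` and `2^N ∣ Q₂` (the tree's proof verbatim with `root_rel_mod`).
[cite: Cassels1991LecturesEllipticCurves, §15] [cite: CremonaAlgorithms1997, §3.6] -/
theorem sig8Check_sound_mod {a b c : ℤ} {z : ℤ × ℤ × ℤ} {t₁ t₂ : ℤ} {N : ℕ}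
    {ε₁ ε₂ ε₃ : ℤ} (h : sig8Check a b c z t₁ t₂ N ε₁ ε₂ ε₃ = true) (v : ℤ × ℤ × ℤ × ℤ)
    (hprim : ¬ ((2 : ℤ) ∣ v.1 ∧ (2 : ℤ) ∣ v.2.1 ∧ (2 : ℤ) ∣ v.2.2.1 ∧ (2 : ℤ) ∣ v.2.2.2))
    (h0 : (2 : ℤ) ^ N ∣ (killQ a b c z t₁ t₂ v).1 ∧ (2 : ℤ) ^ N ∣ (killQ a b c z t₁ t₂ v).2) :
    False := by
  obtain ⟨r₀, r₁, r₂, n⟩ := v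
  simp only [sig8Check, Bool.and_eq_true] at h
  obtain ⟨⟨⟨⟨⟨⟨⟨hk₁, hk₂⟩, hk₃⟩, hu₁₂⟩, hu₁₃⟩, hu₂₃⟩, hrat⟩, hwalk⟩ := h
  simp only [rootOK, unitOK, Bool.and_eq_true, Bool.not_eq_true', decide_eq_true_eq,
    decide_eq_false_iff_not] at hk₁ hk₂ hk₃ hu₁₂ hu₁₃ hu₂₃
  have hf₁₂ : ¬ (2 : ℤ) ∣ (splitPow 2 N (ε₁ - ε₂)).2 := fun hd => hu₁₂ (Int.emod_eq_zero_of_dvd hd)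
  have hf₁₃ : ¬ (2 : ℤ) ∣ (splitPow 2 N (ε₁ - ε₃)).2 := fun hd => hu₁₃ (Int.emod_eq_zero_of_dvd hd)
  have hf₂₃ : ¬ (2 : ℤ) ∣ (splitPow 2 N (ε₂ - ε₃)).2 := fun hd => hu₂₃ (Int.emod_eq_zero_of_dvd hd)
  -- the three root relations
  have rel : ∀ ε : ℤ, (ε ^ 3 + a * ε ^ 2 + b * ε + c) % ((2 ^ N : ℕ) : ℤ) = 0 →
      (2 : ℤ) ^ N ∣ (2 : ℤ) ^ (rootData 2 N z t₁ t₂ ε).2.1 * (rootData 2 N z t₁ t₂ ε).2.2 *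
          (r₀ + r₁ * ε + r₂ * ε ^ 2) ^ 2 - ((zsq a b c z (r₀, r₁, r₂)).1 - n ^ 2 * (rootData 2 N z t₁ t₂ ε).1) := by
    intro ε hg
    have h1 := root_rel_mod hg (by exact_mod_cast h0)
    have h2 := splitPow_spec 2 N ((z.1 + z.2.1 * ε + z.2.2 * ε ^ 2) % ((2 ^ N : ℕ) : ℤ))
    simp only [Nat.cast_ofNat] at h1 h2
    simp only [rootData]
    rw [← h2]
    exact h1
  have rel₁ := rel ε₁ hk₁.1
  have rel₂ := rel ε₂ hk₂.1
  have rel₃ := rel ε₃ hk₃.1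
  -- name the data
  generalize hw₀ : (zsq a b c z (r₀, r₁, r₂)).1 = w₀ at rel₁ rel₂ rel₃
  generalize hD : (splitPow 2 N (ε₁ - ε₂)).1 + (splitPow 2 N (ε₁ - ε₃)).1 + (splitPow 2 N (ε₂ - ε₃)).1 = D
    at hwalk
  generalize hρ₁ : rootData 2 N z t₁ t₂ ε₁ = ρ₁ at hk₁ rel₁ hrat hwalk
  generalize hρ₂ : rootData 2 N z t₁ t₂ ε₂ = ρ₂ at hk₂ rel₂ hrat hwalk
  generalize hρ₃ : rootData 2 N z t₁ t₂ ε₃ = ρ₃ at hk₃ rel₃ hrat hwalk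
  have hu₁ : ¬ (2 : ℤ) ∣ ρ₁.2.2 := fun hd => hk₁.2 (Int.emod_eq_zero_of_dvd hd)
  have hu₂ : ¬ (2 : ℤ) ∣ ρ₂.2.2 := fun hd => hk₂.2 (Int.emod_eq_zero_of_dvd hd)
  have hu₃ : ¬ (2 : ℤ) ∣ ρ₃.2.2 := fun hd => hk₃.2 (Int.emod_eq_zero_of_dvd hd)
  have hLu : ∀ ρ ∈ [ρ₁, ρ₂, ρ₃], ¬ (2 : ℤ) ∣ ρ.2.2 := by
    intro ρ hρ
    simp only [List.mem_cons, List.not_mem_nil, or_false] at hρ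
    rcases hρ with rfl | rfl | rfl
    · exact hu₁
    · exact hu₂
    · exact hu₃
  by_cases hn : (2 : ℤ) ∣ n
  · -- `2 ∣ n`: a root with `2^(D+1) ∤ R` by the index lemma, then `caseB8`
    have hex : ∃ ρ ∈ [ρ₁, ρ₂, ρ₃], ∃ R : ℤ, ¬ (2 : ℤ) ^ (D + 1) ∣ R ∧
        (2 : ℤ) ^ N ∣ (2 : ℤ) ^ ρ.2.1 * ρ.2.2 * R ^ 2 - (w₀ - n ^ 2 * ρ.1) := by
      by_contra hall
      push Not at hall
      have d₁ : (2 : ℤ) ^ (D + 1) ∣ r₀ + r₁ * ε₁ + r₂ * ε₁ ^ 2 := by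
        by_contra hnd; exact hall ρ₁ (by simp) _ hnd rel₁
      have d₂ : (2 : ℤ) ^ (D + 1) ∣ r₀ + r₁ * ε₂ + r₂ * ε₂ ^ 2 := by
        by_contra hnd; exact hall ρ₂ (by simp) _ hnd rel₂
      have d₃ : (2 : ℤ) ^ (D + 1) ∣ r₀ + r₁ * ε₃ + r₂ * ε₃ ^ 2 := by
        by_contra hnd; exact hall ρ₃ (by simp) _ hnd rel₃
      rw [← hD] at d₁ d₂ d₃
      have s₁₂ := splitPow_spec 2 N (ε₁ - ε₂)
      have s₁₃ := splitPow_spec 2 N (ε₁ - ε₃)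
      have s₂₃ := splitPow_spec 2 N (ε₂ - ε₃)
      simp only [Nat.cast_ofNat] at s₁₂ s₁₃ s₂₃
      have hidx := index_lemma Nat.prime_two s₁₂ s₁₃ s₂₃ hf₁₂ hf₁₃ hf₂₃ d₁ d₂ d₃
      simp only [Nat.cast_ofNat] at hidx
      exact hprim ⟨hidx.1, hidx.2.1, hidx.2.2, hn⟩
    obtain ⟨ρ, hρ, R, hR, hrel⟩ := hex
    refine caseB8 hwalk ?_ hrat hρ hR hrel
    intro ρ hρ
    simp only [List.mem_cons, List.not_mem_nil, or_false] at hρ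
    rcases hρ with rfl | rfl | rfl
    · exact ⟨hu₁, le_max_left _ _, _, rel₁⟩
    · exact ⟨hu₂, le_trans (le_max_left _ _) (le_max_right _ _), _, rel₂⟩
    · exact ⟨hu₃, le_trans (le_max_right _ _) (le_max_right _ _), _, rel₃⟩
  · -- `2 ∤ n`: the walk at offset `0` with `y = w₀ / n²`
    refine kill_of_walk8 (K := 0) (Nat.zero_le _) (by rfl) hwalk hLu (y₀ := w₀) hn ?_
    intro ρ hρ
    simp only [List.mem_cons, List.not_mem_nil, or_false] at hρ
    rcases hρ with rfl | rfl | rfl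
    · exact ⟨r₀ + r₁ * ε₁ + r₂ * ε₁ ^ 2, by rw [pow_zero, one_mul]; exact rel₁⟩
    · exact ⟨r₀ + r₁ * ε₂ + r₂ * ε₂ ^ 2, by rw [pow_zero, one_mul]; exact rel₂⟩
    · exact ⟨r₀ + r₁ * ε₃ + r₂ * ε₃ ^ 2, by rw [pow_zero, one_mul]; exact rel₃⟩

end Summit.BirchSwinnertonDyer.BirchSwinnertonDyer.Theorems.ShaPrimaryTransferSelmerCubicKill
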